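import Summits.QuantumFields.Balaban3D.Proofs.Run3OldOutside
import Summits.QuantumFields.Balaban3D.Proofs.SeriesAC

/-!
# `Summit.QuantumFields.Balaban3D.Proofs.LeavesOldAC` — the step leaf C10 `OldOutside` (p. 272 L28–31 «we estimate a sum of all terms
# 𝒫_j(Y_j, U_{k+1}) with localizations Y_j not contained in Ω_{k+1} … by O(1)|Z_k|») AT THE AC TOWER's pieces
# `SeriesAC.TowerBaseAC.seriesPiecesAC B 𝔖 Cp k` — seat p5's `Run3OldOutside` §Series twinned over `TowerBaseAC` (uncapped masses, `AvgAC`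
# averaging) — lane `pub-balaban3d`, seat alpha-1 (definition request `defn-AlphaInputsT3AC` of route `UnitScaleTilt`; feed `Thm2AC`)

A statement about the previous-scale terms `oldVal` of the expansion data ((43)–(45)) and seat p1's regions; proofs are seat p5's verbatim
with `seriesPieces` ↦ `seriesPiecesAC` (the callees in `OldOutsideDropped`/`OldTermsCount`/`TorusBalls` are generic).  [folklore] bookkeeping;
nothing of [Balaban1985UV3] newly asserted.
-/

noncomputable section

open MeasureTheory Finset
open scoped BigOperators

namespace Summit.QuantumFields.Balaban3D.Proofs.LeavesOldAC

open Literature.MathematicalPhysics.QuantumFieldTheory.Balaban1983to89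
open Literature.MathematicalPhysics.QuantumFieldTheory.Balaban1983to89.B10SectAGathering (OldOutside)
open Literature.MathematicalPhysics.QuantumFieldTheory.Balaban1983to89.B10SectCExpansion (VertexGeometry Bound44)
open Literature.MathematicalPhysics.QuantumFieldTheory.Balaban1985CMP102.Setting (Scales)
open Summit.QuantumFields.Balaban3D.Carriers


open Summit.QuantumFields.Balaban3D.Proofs.Thresholds (gammaOf gammaOf_spec)
open Summit.QuantumFields.Balaban3D.Proofs.TowerAC
open Summit.QuantumFields.Balaban3D.Proofs.SeriesAC

variable {L : ℕ} {S : Scales L} {G : Type} [GaugeGroup G] [MeasurableSpace G] [HaarData G]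
  {V : Type} [NormedAddCommGroup V] [NormedSpace ℂ V] {Nc : ℕ → ℕ} [∀ k, NeZero (Nc k)]

variable (B : TowerBaseAC S G) (𝔖 : ∀ k, StepSeries S G V (Nc k) k) (Cp : ∀ k, PiecesParams S k) (k : ℕ)

/-- **The definitional `hdiff` at the series' pieces, over the blocks of histories with `Z_k(h)^{(j)} ≠ ∅`**: `Pold`/`PoldIn`
are p1's `oldSum`/`oldSumIn` of the same signed data `oldVal` (dropped terms replaced by `0`), so `|Pold − PoldIn| ≤ Σ 𝟙[Drop]·
|oldVal|` (the shapes `hPold`/`hPoldIn` of `OldOutsideDropped.abs_pold_sub_poldIn_le` hold by `rfl`; triangle inequality); blocks of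
histories with `Z_k(h)^{(j)} = ∅` carry no dropped term and are filtered away. [cite: Balaban1985UV3, (58) p.270 + p.272 L28–31] -/
theorem abs_pold_sub_poldIn_le_seriesAC (h : Hist S.P (k + 1)) (U : GaugeField S.P (k + 1) G) :
    |(B.seriesPiecesAC 𝔖 Cp k).Pold h U - (B.seriesPiecesAC 𝔖 Cp k).PoldIn h U| ≤
      ∑ j ∈ Icc 1 k, ∑ y ∈ (oldBlocks B.M₁ B.Rcol h j).filter
          (fun _ => ((univ : Finset (Site S.P j)) \ newSites B.M₁ B.Rcol h j).Nonempty),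
        ∑ n ∈ range ((𝔖 k).Ndeg j + 1), ∑ c ∈ Fintype.piFinset (fun _ : Fin n => oldBonds B.M₁ B.Rcol h j y),
          (if Drop B.M₁ B.Rcol h j y n c then |(𝔖 k).oldVal h U j y n c| else 0) := by
  have e1 : (B.seriesPiecesAC 𝔖 Cp k).Pold h U = ∑ j ∈ Icc 1 k, ∑ y ∈ oldBlocks B.M₁ B.Rcol h j,
      ∑ n ∈ range ((𝔖 k).Ndeg j + 1), ∑ c ∈ Fintype.piFinset (fun _ : Fin n => oldBonds B.M₁ B.Rcol h j y),
        (𝔖 k).oldVal h U j y n c := rfl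
  have e2 : (B.seriesPiecesAC 𝔖 Cp k).PoldIn h U = ∑ j ∈ Icc 1 k, ∑ y ∈ oldBlocks B.M₁ B.Rcol h j,
      ∑ n ∈ range ((𝔖 k).Ndeg j + 1), ∑ c ∈ Fintype.piFinset (fun _ : Fin n => oldBonds B.M₁ B.Rcol h j y),
        (if Drop B.M₁ B.Rcol h j y n c then 0 else (𝔖 k).oldVal h U j y n c) := rfl
  have h1 : |(B.seriesPiecesAC 𝔖 Cp k).Pold h U - (B.seriesPiecesAC 𝔖 Cp k).PoldIn h U| ≤
      ∑ j ∈ Icc 1 k, ∑ y ∈ oldBlocks B.M₁ B.Rcol h j,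
        ∑ n ∈ range ((𝔖 k).Ndeg j + 1), ∑ c ∈ Fintype.piFinset (fun _ : Fin n => oldBonds B.M₁ B.Rcol h j y),
          (if Drop B.M₁ B.Rcol h j y n c then |(𝔖 k).oldVal h U j y n c| else 0) := by
    rw [e1, e2, ← Finset.sum_sub_distrib]
    refine (Finset.abs_sum_le_sum_abs _ _).trans (Finset.sum_le_sum fun j _ => ?_)
    rw [← Finset.sum_sub_distrib]
    refine (Finset.abs_sum_le_sum_abs _ _).trans (Finset.sum_le_sum fun y _ => ?_)
    rw [← Finset.sum_sub_distrib]
    refine (Finset.abs_sum_le_sum_abs _ _).trans (Finset.sum_le_sum fun n _ => ?_)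
    rw [← Finset.sum_sub_distrib]
    refine (Finset.abs_sum_le_sum_abs _ _).trans (Finset.sum_le_sum fun c _ => ?_)
    by_cases hd : Drop B.M₁ B.Rcol h j y n c <;> simp [hd]
  have hnn : ∀ (j : ℕ) (y : Site S.P j), 0 ≤ ∑ n ∈ range ((𝔖 k).Ndeg j + 1),
      ∑ c ∈ Fintype.piFinset (fun _ : Fin n => oldBonds B.M₁ B.Rcol h j y),
        (if Drop B.M₁ B.Rcol h j y n c then |(𝔖 k).oldVal h U j y n c| else 0) :=
    fun j y => sum_nonneg fun n _ => sum_nonneg fun c _ => by split_ifs <;> simp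
  refine h1.trans (sum_le_sum fun j _ => ?_)
  by_cases hne : ((univ : Finset (Site S.P j)) \ newSites B.M₁ B.Rcol h j).Nonempty
  · exact sum_le_sum_of_subset_of_nonneg (fun y hy => mem_filter.2 ⟨hy, hne⟩) fun y _ _ => hnn j y
  · refine le_of_eq_of_le (sum_eq_zero fun y _ => sum_eq_zero fun n _ => sum_eq_zero fun c _ => ?_)
      (sum_nonneg fun y _ => hnn j y)
    rw [if_neg fun hd => hne (nonempty_compl_newSites_of_drop B.M₁ B.Rcol h j y n c hd)]

/-- **THE SHELL COUNT `hcount` AT THE CONCRETE CARRIERS** (from `OldTermsCount.card_near_compl_newSites_le`), for any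
distance-like `D` attained at a site of `Z_k(h)^{(j)}`: among the blocks of histories with `Z_k(h)^{(j)} ≠ ∅`, those with shell
index `⌊D/(M₁ℓ_j)⌋ ≤ m` number at most `8M₁⁶·(m+1)³·(M₁ℓ_j)⁻³·|Z_k(h)|` (`j ≤ k`, `k + 1 ≤ m + K`). [cite: Balaban1985UV3, Thm 2 proof p.272 L28–31] -/
theorem shellCount_seriesAC (hM : 0 < B.M₁) (hk : k + 1 ≤ S.m + S.K)
    (D : Hist S.P (k + 1) → (j : ℕ) → Site S.P j → ℝ)
    (hD : ∀ (h : Hist S.P (k + 1)) (j : ℕ) (y : Site S.P j),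
      ((univ : Finset (Site S.P j)) \ newSites B.M₁ B.Rcol h j).Nonempty →
        ∃ z, z ∉ newSites B.M₁ B.Rcol h j ∧ D h j y = ell S.P k j * (Site.tdist z y : ℝ))
    (h : Hist S.P (k + 1)) (j : ℕ) (hj : j ∈ Icc 1 k) (m : ℕ) :
    ((((oldBlocks B.M₁ B.Rcol h j).filter
        (fun _ => ((univ : Finset (Site S.P j)) \ newSites B.M₁ B.Rcol h j).Nonempty)).filter
        (fun y => ⌊D h j y / ((B.M₁ : ℝ) * ell S.P k j)⌋₊ ≤ m)).card : ℝ) ≤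
      (8 * (B.M₁ : ℝ) ^ 6) * ((m : ℝ) + 1) ^ 3 *
        (((B.M₁ : ℝ) * ell S.P k j)⁻¹ ^ 3 * (B.seriesPiecesAC 𝔖 Cp k).Zvol h) := by
  classical
  have hjk : j ≤ k := (mem_Icc.1 hj).2
  -- the filtered blocks sit inside the sites near the complement of `newSites`
  have hsub : ((oldBlocks B.M₁ B.Rcol h j).filter
        (fun _ => ((univ : Finset (Site S.P j)) \ newSites B.M₁ B.Rcol h j).Nonempty)).filter
        (fun y => ⌊D h j y / ((B.M₁ : ℝ) * ell S.P k j)⌋₊ ≤ m) ⊆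
      univ.filter (fun y : Site S.P j => ∃ z, z ∉ newSites B.M₁ B.Rcol h j ∧
        Site.tdist z y ≤ ((m + 1) * B.M₁ - 1)) := by
    intro y hy
    rw [mem_filter, mem_filter] at hy
    obtain ⟨z, hz, hDz⟩ := hD h j y hy.1.2
    have hm := hy.2
    rw [hDz] at hm
    exact mem_filter.2 ⟨mem_univ _, z, hz, le_of_floor_le hM (ell_pos S.P k j) hm⟩
  have hcnt := card_near_compl_newSites_le B.M₁ B.Rcol h hjk (by exact hk) ((m + 1) * B.M₁ - 1)
  have hR : (m + 1) * B.M₁ - 1 + 1 = (m + 1) * B.M₁ := by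
    have : 1 ≤ (m + 1) * B.M₁ := Nat.one_le_iff_ne_zero.2 (Nat.mul_ne_zero (by omega) (by omega)); omega
  rw [hR, ScalesArithmetic.P_d, ScalesArithmetic.P_L] at hcnt
  have hc := (card_le_card hsub).trans hcnt
  have hc' : ((((oldBlocks B.M₁ B.Rcol h j).filter
        (fun _ => ((univ : Finset (Site S.P j)) \ newSites B.M₁ B.Rcol h j).Nonempty)).filter
        (fun y => ⌊D h j y / ((B.M₁ : ℝ) * ell S.P k j)⌋₊ ≤ m)).card : ℝ) ≤
      (((2 * ((m + 1) * B.M₁)) ^ 3 * (L ^ (3 * (k - j)) * ZVol B.M₁ B.Rcol (k + 1) h k) : ℕ) : ℝ) := by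
    exact_mod_cast hc
  refine hc'.trans (le_of_eq ?_)
  show _ = (8 * (B.M₁ : ℝ) ^ 6) * ((m : ℝ) + 1) ^ 3 *
    (((B.M₁ : ℝ) * ell S.P k j)⁻¹ ^ 3 * ((ZVol B.M₁ B.Rcol (k + 1) h k : ℕ) : ℝ))
  rw [inv_M_ell]
  have hM' : (B.M₁ : ℝ) ≠ 0 := by exact_mod_cast hM.ne'
  push_cast
  field_simp
  ring

/-- **THE ONE-BOND SUM `hZ′` AT THE CONCRETE CARRIERS**: over p1's admissible bonds `oldBonds h j y₀` (any bond set would do),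
with `dist = ℓ_j·tdist` (p1 `oldGeom`), the half-rate one-bond sum of `dropped_blockSum_le` is bounded by the torus constant
`Z′(κ₁/(2M₁))` of `bondSum_le`. [folklore] -/
theorem bondSum_genericAC (M₁ : ℕ) (Rcol : ℕ → ℕ) {κ₁ : ℝ} (hκ₁ : 0 < κ₁) (hM : 0 < M₁) (h : Hist S.P (k + 1)) (j : ℕ)
    (y₀ : Site S.P j) :
    ∑ b ∈ oldBonds M₁ Rcol h j y₀,
      Real.exp (-(κ₁ / 2 * ((M₁ : ℝ) * ell S.P k j)⁻¹ * (oldGeom S.P k j).dist ((oldGeom S.P k j).cminus b) y₀)) *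
        ((ell S.P k j)⁻¹ * (oldGeom S.P k j).dist ((oldGeom S.P k j).cminus b) y₀) ≤
      2 / (κ₁ / (2 * M₁)) * (24 * (48 / (κ₁ / (2 * M₁) / 2) ^ 3 * Real.exp (κ₁ / (2 * M₁) / 2 / 2) /
        (1 - Real.exp (-(κ₁ / (2 * M₁) / 2 / 2)))) * 1) := by
  have hM' : (0 : ℝ) < M₁ := by exact_mod_cast hM
  have ha : 0 < κ₁ / (2 * (M₁ : ℝ)) := by positivity
  have hℓ : ell S.P k j ≠ 0 := (ell_pos S.P k j).ne'
  refine le_of_eq_of_le (sum_congr rfl fun b _ => ?_) (bondSum_le (ScalesArithmetic.P_d S) _ y₀ ha)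
  show Real.exp (-(κ₁ / 2 * ((M₁ : ℝ) * ell S.P k j)⁻¹ * (ell S.P k j * (Site.tdist b.src y₀ : ℝ)))) *
      ((ell S.P k j)⁻¹ * (ell S.P k j * (Site.tdist b.src y₀ : ℝ))) =
      Real.exp (-(κ₁ / (2 * M₁) * (Site.tdist b.src y₀ : ℝ))) * (Site.tdist b.src y₀ : ℝ)
  congr 1
  · congr 1
    field_simp
  · field_simp

/-- **LEAF-LEDGER C10 `oldOutside` AT THE CONCRETE PIECES `seriesPieces B 𝔖 C k`, ALL SCALES** — the absorption of the dropped
previous-scale terms into `O(1)|Z_k|` (p. 272 L28–31) with every carrier/arithmetic input of `oldOutside_of_bound44`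
DISCHARGED on p1's (43) index geometry.  (α) END HYPOTHESES: the display (44) p. 267 about the data `oldVal` at every old
scale `j ∈ [1, k]` with the coupling factor `g_k p(g_k)` of the configuration `U_{k+1}` (`h44`); the degree floor «n ≥ 2»
of (43) (`hfloor`); the smallness `8L²B₃Z′·g_k p(g_k) ≤ ½` («for g_{k−1} sufficiently small», (45); threshold γ_OO).
Window facts: `0 < g_k ≤ 1`, `0 ≤ b₀`; constants `C ≥ 0`, `B₃ ≥ 0`, `κ₁ > 0`, `M₁ > 0`; standing range `k + 1 ≤ m + K`.
Conclusion: `OldOutside (seriesPieces B 𝔖 C k) C₆` with the k-UNIFORM constant `C₆ = (C/2)·8M₁⁶·S(κ₁/2)·M₁⁻³·L/(L−1)`,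
`S(κ) = 48/κ³·e^{κ/2}/(1 − e^{−κ/2})` (the factor `((8L²B₃Z′)g_k p(g_k))² ≤ ¼` absorbed by the smallness).
[cite: Balaban1985UV3, (43)–(45) pp.266–267 + Thm 2 proof p.272 L28–31] -/
theorem oldOutside_seriesAC (hk : k + 1 ≤ S.m + S.K) {κ₁ B₃ C : ℝ} (hC : 0 ≤ C) (hB : 0 ≤ B₃) (hκ₁ : 0 < κ₁)
    (hM : 0 < B.M₁) (hb₀ : 0 ≤ B.b₀) (hg : 0 < S.gk k) (hg1 : S.gk k ≤ 1)
    (h44 : ∀ (h : Hist S.P (k + 1)) (U : GaugeField S.P (k + 1) G), ∀ j ∈ Icc 1 k,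
      Bound44 (oldGeom S.P k j) (fun y n c => (𝔖 k).oldVal h U j y n c) κ₁ (B.M₁ : ℝ) (ell S.P k j) (L : ℝ) B₃
        (S.gk k) (B10.pFun B.b₀ B.p₀ (S.gk k)) C)
    (hfloor : ∀ (h : Hist S.P (k + 1)) (U : GaugeField S.P (k + 1) G), ∀ j ∈ Icc 1 k, ∀ (y : Site S.P j) (n : ℕ)
      (c : Fin n → PBond S.P j), (𝔖 k).oldVal h U j y n c ≠ 0 → 2 ≤ n)
    (hsmall : 8 * (L : ℝ) ^ 2 * B₃ *
        (2 / (κ₁ / (2 * B.M₁)) * (24 * (48 / (κ₁ / (2 * B.M₁) / 2) ^ 3 * Real.exp (κ₁ / (2 * B.M₁) / 2 / 2) /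
          (1 - Real.exp (-(κ₁ / (2 * B.M₁) / 2 / 2)))) * 1)) *
        S.gk k * B10.pFun B.b₀ B.p₀ (S.gk k) ≤ 1 / 2) :
    OldOutside (B.seriesPiecesAC 𝔖 Cp k)
      (C / 2 * (8 * (B.M₁ : ℝ) ^ 6) * (48 / (κ₁ / 2) ^ 3 * Real.exp (κ₁ / 2 / 2) / (1 - Real.exp (-(κ₁ / 2 / 2)))) *
        (B.M₁ : ℝ)⁻¹ ^ 3 * ((L : ℝ) / ((L : ℝ) - 1))) := by
  classical
  -- abbreviations for the two torus constants
  set Z' : ℝ := 2 / (κ₁ / (2 * B.M₁)) * (24 * (48 / (κ₁ / (2 * B.M₁) / 2) ^ 3 * Real.exp (κ₁ / (2 * B.M₁) / 2 / 2) /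
    (1 - Real.exp (-(κ₁ / (2 * B.M₁) / 2 / 2)))) * 1) with hZ'def
  set Ssh : ℝ := 48 / (κ₁ / 2) ^ 3 * Real.exp (κ₁ / 2 / 2) / (1 - Real.exp (-(κ₁ / 2 / 2))) with hSdef
  have hM' : (0 : ℝ) < B.M₁ := by exact_mod_cast hM
  have hL : (1 : ℝ) < L := by exact_mod_cast S.hL.2
  have hpg : 0 ≤ B10.pFun B.b₀ B.p₀ (S.gk k) := B10.pFun_nonneg _ _ _ hb₀ hg hg1
  have hSsh0 : 0 ≤ Ssh := by
    rw [hSdef]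
    have h1 : Real.exp (-(κ₁ / 2 / 2)) < 1 := Real.exp_lt_one_iff.2 (by linarith)
    have h2 : 0 < 1 - Real.exp (-(κ₁ / 2 / 2)) := by linarith
    positivity
  have hZ'0 : 0 ≤ Z' := by
    rw [hZ'def]
    have ha : 0 < κ₁ / (2 * (B.M₁ : ℝ)) := by positivity
    have h1 : Real.exp (-(κ₁ / (2 * B.M₁) / 2 / 2)) < 1 := Real.exp_lt_one_iff.2 (by linarith)
    have h2 : 0 < 1 - Real.exp (-(κ₁ / (2 * B.M₁) / 2 / 2)) := by linarith
    positivity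
  -- the reach property of the dropped terms for the distance `D` (p1's `Drop` is its reading)
  have hreach : ∀ (h : Hist S.P (k + 1)) (U : GaugeField S.P (k + 1) G), ∀ j ∈ Icc 1 k, ∀ (y : Site S.P j) (n : ℕ)
      (c : Fin n → PBond S.P j), Drop B.M₁ B.Rcol h j y n c → (𝔖 k).oldVal h U j y n c ≠ 0 →
        ∃ i : Fin n, (if hne : ((univ : Finset (Site S.P j)) \ newSites B.M₁ B.Rcol h j).Nonempty then
          ell S.P k j * ((univ \ newSites B.M₁ B.Rcol h j).inf' hne fun z => (Site.tdist z y : ℝ)) else 0) ≤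
          ell S.P k j * (Site.tdist (c i).src y : ℝ) := by
    intro h U j hj y n c hd hne0
    have hn : 1 ≤ n := le_trans one_le_two (hfloor h U j hj y n c hne0)
    rcases hd with hy | ⟨i, hi⟩
    · refine ⟨⟨0, hn⟩, (infDist_le B.M₁ B.Rcol h j y hy).trans ?_⟩
      have h0 : (Site.tdist y y : ℝ) = 0 := by simp [Site.tdist]
      rw [h0, mul_zero]
      exact mul_nonneg (ell_pos S.P k j).le (Nat.cast_nonneg _)
    · exact ⟨i, infDist_le B.M₁ B.Rcol h j y hi⟩
  -- the main application
  have main := oldOutside_of_bound44 (T := (B.withSeriesAC 𝔖 Cp).tower3.toTowerRun) (B.seriesPiecesAC 𝔖 Cp k)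
    (fun j => oldGeom S.P k j) (fun h U j y n c => (𝔖 k).oldVal h U j y n c)
    (fun h j y => oldBonds B.M₁ B.Rcol h j y) (𝔖 k).Ndeg (fun h j y n c => Drop B.M₁ B.Rcol h j y n c)
    (fun h j y => if hne : ((univ : Finset (Site S.P j)) \ newSites B.M₁ B.Rcol h j).Nonempty then
      ell S.P k j * ((univ \ newSites B.M₁ B.Rcol h j).inf' hne fun z => (Site.tdist z y : ℝ)) else 0)
    (fun h j => (oldBlocks B.M₁ B.Rcol h j).filter
      (fun _ => ((univ : Finset (Site S.P j)) \ newSites B.M₁ B.Rcol h j).Nonempty))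
    (ell S.P k) (κ₁ := κ₁) (M₁ := (B.M₁ : ℝ)) (L := (L : ℝ)) (B₃ := B₃) (g := S.gk k)
    (pg := B10.pFun B.b₀ B.p₀ (S.gk k)) (C := C) (Z' := Z') (csh := 8 * (B.M₁ : ℝ) ^ 6) (S := Ssh)
    hC hB hg.le hpg hM' hκ₁.le hL (by positivity) hSsh0
    (fun j _ => ell_eq S k j)
    (fun j => oldGeom_dist_nonneg S.P k j)
    (fun h j y => infDist_nonneg B.M₁ B.Rcol h j y)
    h44 hfloor hreach
    (fun h j _ y₀ => by rw [hZ'def]; exact bondSum_genericAC k B.M₁ B.Rcol hκ₁ hM h j y₀)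
    (fun j _ => by
      have h1 : ell S.P k j ^ 2 ≤ 1 := pow_le_one₀ (ell_pos S.P k j).le (ell_le_one S k j)
      have h0 : 0 ≤ 8 * (L : ℝ) ^ 2 * B₃ * Z' * S.gk k * B10.pFun B.b₀ B.p₀ (S.gk k) := by
        have := hg.le; positivity
      calc 8 * (L : ℝ) ^ 2 * B₃ * Z' * S.gk k * B10.pFun B.b₀ B.p₀ (S.gk k) * ell S.P k j ^ 2
          ≤ 8 * (L : ℝ) ^ 2 * B₃ * Z' * S.gk k * B10.pFun B.b₀ B.p₀ (S.gk k) * 1 :=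
            mul_le_mul_of_nonneg_left h1 h0
        _ ≤ 1 / 2 := by rw [mul_one]; exact hsmall)
    (abs_pold_sub_poldIn_le_seriesAC B 𝔖 Cp k)
    (fun h j hj m => shellCount_seriesAC B 𝔖 Cp k hM hk _ (fun h j y hne => infDist_eq B.M₁ B.Rcol h j y hne) h j hj m)
    (fun M => by rw [hSdef]; exact shell_series_le (half_pos hκ₁) M)
  -- absorb `((8L²B₃Z′)·g·pg)² ≤ ¼` into the constant (k-uniformity)
  refine oldOutside_mono main ?_
  have hx : ((8 * (L : ℝ) ^ 2 * B₃ * Z') * S.gk k * B10.pFun B.b₀ B.p₀ (S.gk k)) ^ 2 ≤ 1 / 4 := by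
    have h0 : 0 ≤ (8 * (L : ℝ) ^ 2 * B₃ * Z') * S.gk k * B10.pFun B.b₀ B.p₀ (S.gk k) := by
      have := hg.le; positivity
    nlinarith
  have hrest : 0 ≤ (8 * (B.M₁ : ℝ) ^ 6) * Ssh * (B.M₁ : ℝ)⁻¹ ^ 3 * ((L : ℝ) / ((L : ℝ) - 1)) := by
    have : 0 < (L : ℝ) - 1 := by linarith
    positivity
  calc 2 * C * ((8 * (L : ℝ) ^ 2 * B₃ * Z') * S.gk k * B10.pFun B.b₀ B.p₀ (S.gk k)) ^ 2 * (8 * (B.M₁ : ℝ) ^ 6) * Ssh *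
        (B.M₁ : ℝ)⁻¹ ^ 3 * ((L : ℝ) / ((L : ℝ) - 1))
      = (2 * C * ((8 * (L : ℝ) ^ 2 * B₃ * Z') * S.gk k * B10.pFun B.b₀ B.p₀ (S.gk k)) ^ 2) *
        ((8 * (B.M₁ : ℝ) ^ 6) * Ssh * (B.M₁ : ℝ)⁻¹ ^ 3 * ((L : ℝ) / ((L : ℝ) - 1))) := by ring
    _ ≤ (2 * C * (1 / 4)) * ((8 * (B.M₁ : ℝ) ^ 6) * Ssh * (B.M₁ : ℝ)⁻¹ ^ 3 * ((L : ℝ) / ((L : ℝ) - 1))) :=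
        mul_le_mul_of_nonneg_right (mul_le_mul_of_nonneg_left hx (by positivity)) hrest
    _ = C / 2 * (8 * (B.M₁ : ℝ) ^ 6) * Ssh * (B.M₁ : ℝ)⁻¹ ^ 3 * ((L : ℝ) / ((L : ℝ) - 1)) := by ring

/-- **C10 at `seriesPieces` in the R-EPS0′ / `gammaMin` form**: the smallness `hsmall` FROM the coupling threshold
`g_k ≤ γ_OO := gammaOf b₀ p₀ (1/(2·8L²B₃Z′))` (seat p2's `Thresholds.gammaOf`, «g·p(g) ≤ σ for g ≤ gammaOf b₀ p₀ σ»); this is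
the number seat p3 puts into `gammaMin […, γ_OO, …]`. [cite: Balaban1985UV3, (45) p.267 + Thm 2 proof p.272 L28–31] -/
theorem oldOutside_series_gammaAC (hk : k + 1 ≤ S.m + S.K) {κ₁ B₃ C : ℝ} (hC : 0 ≤ C) (hB : 0 ≤ B₃) (hκ₁ : 0 < κ₁)
    (hM : 0 < B.M₁) (hb₀ : 0 < B.b₀) (hp₀ : 0 < B.p₀) (hg : 0 < S.gk k) (hg1 : S.gk k ≤ 1)
    (h44 : ∀ (h : Hist S.P (k + 1)) (U : GaugeField S.P (k + 1) G), ∀ j ∈ Icc 1 k,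
      Bound44 (oldGeom S.P k j) (fun y n c => (𝔖 k).oldVal h U j y n c) κ₁ (B.M₁ : ℝ) (ell S.P k j) (L : ℝ) B₃
        (S.gk k) (B10.pFun B.b₀ B.p₀ (S.gk k)) C)
    (hfloor : ∀ (h : Hist S.P (k + 1)) (U : GaugeField S.P (k + 1) G), ∀ j ∈ Icc 1 k, ∀ (y : Site S.P j) (n : ℕ)
      (c : Fin n → PBond S.P j), (𝔖 k).oldVal h U j y n c ≠ 0 → 2 ≤ n)
    (hγ : S.gk k ≤ gammaOf B.b₀ B.p₀ (1 / (2 * (8 * (L : ℝ) ^ 2 * B₃ *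
        (2 / (κ₁ / (2 * B.M₁)) * (24 * (48 / (κ₁ / (2 * B.M₁) / 2) ^ 3 * Real.exp (κ₁ / (2 * B.M₁) / 2 / 2) /
          (1 - Real.exp (-(κ₁ / (2 * B.M₁) / 2 / 2)))) * 1)))))) :
    OldOutside (B.seriesPiecesAC 𝔖 Cp k)
      (C / 2 * (8 * (B.M₁ : ℝ) ^ 6) * (48 / (κ₁ / 2) ^ 3 * Real.exp (κ₁ / 2 / 2) / (1 - Real.exp (-(κ₁ / 2 / 2)))) *
        (B.M₁ : ℝ)⁻¹ ^ 3 * ((L : ℝ) / ((L : ℝ) - 1))) := by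
  set X : ℝ := 8 * (L : ℝ) ^ 2 * B₃ *
    (2 / (κ₁ / (2 * B.M₁)) * (24 * (48 / (κ₁ / (2 * B.M₁) / 2) ^ 3 * Real.exp (κ₁ / (2 * B.M₁) / 2 / 2) /
      (1 - Real.exp (-(κ₁ / (2 * B.M₁) / 2 / 2)))) * 1)) with hXdef
  have hM' : (0 : ℝ) < B.M₁ := by exact_mod_cast hM
  have hX0 : 0 ≤ X := by
    rw [hXdef]
    have ha : 0 < κ₁ / (2 * (B.M₁ : ℝ)) := by positivity
    have h1 : Real.exp (-(κ₁ / (2 * B.M₁) / 2 / 2)) < 1 := Real.exp_lt_one_iff.2 (by linarith)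
    have h2 : 0 < 1 - Real.exp (-(κ₁ / (2 * B.M₁) / 2 / 2)) := by linarith
    positivity
  refine oldOutside_seriesAC B 𝔖 Cp k hk hC hB hκ₁ hM hb₀.le hg hg1 h44 hfloor ?_
  show X * S.gk k * B10.pFun B.b₀ B.p₀ (S.gk k) ≤ 1 / 2
  rcases hX0.eq_or_lt with hX | hX
  · rw [← hX]; norm_num
  · have hσ : 0 ≤ 1 / (2 * X) := by positivity
    have hgp := gammaOf_spec hb₀ hp₀ hσ hg hγ
    calc X * S.gk k * B10.pFun B.b₀ B.p₀ (S.gk k) = X * (S.gk k * B10.pFun B.b₀ B.p₀ (S.gk k)) := by ring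
      _ ≤ X * (1 / (2 * X)) := mul_le_mul_of_nonneg_left hgp hX.le
      _ = 1 / 2 := by field_simp


end Summit.QuantumFields.Balaban3D.Proofs.LeavesOldAC

end
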